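import Mathlib
import Literature.Probability.Distributions.BrascampLiebCalculus
import Literature.MathematicalPhysics.QuantumFieldTheory.Balaban1983to89.T4CubeConvexExtension
import Literature.MathematicalPhysics.QuantumFieldTheory.Balaban1983to89.T4CubeShellBlocks
import Literature.MathematicalPhysics.QuantumFieldTheory.Balaban1983to89.T4CubeShellTowerMarkov

/-!
# `Balaban1983to89.T4CubeShellConditional` — SHELL CONDITIONING OF THE WINDOWED GIBBS LAW ON A CUBE, IV: calculus of block
# (`𝓕_S`-)measurable functions, and CLOSURE OF THE BRASCAMP–LIEB CLASS UNDER CONDITIONING — the law given a shell of coordinates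
# is the windowed Gibbs law of the regularised conditioned potential, again `C²` with `f_xx ≥ λ`
# (S. Friedli, Y. Velenik, *Statistical Mechanics of Lattice Systems*, CUP 2017 = [FriedliVelenik2017] Lemma 6.3, §6.2.1 Lemma 6.7
# (6.7)–(6.10), §6.10.1 (6.110); M. Spivak, *Calculus on Manifolds* 1965 = [Spivak1965] Thm 2-2, 2-3, 2-9; R. Durrett, *Probability*
# 5th ed. 2019 = [Durrett2019] Thm 2.1.12; R. A. Horn, C. R. Johnson, *Matrix Analysis* 2nd ed. 2013 = [HornJohnson2013] Thm 4.3.28;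
# H. J. Brascamp, E. H. Lieb, JFA **22** (1976) = [BrascampLieb1976] Thm 4.1; J. Glimm, A. Jaffe, *Quantum Physics* 2nd ed. 1987
# = [GlimmJaffe1987] §4.3)

statement-and-proof file: textbook calculus ∕ probability on the tree's cube model, every public declaration cite-tagged; nothing
here is a claim about the Yang–Mills mass gap

CITATION HEADER (lean-in-tree rule).  Ideation cell `ym-nodeO-ideate` (portfolio track), seat P8 «dual witness for the
β-interval bounds», memo `memos/ROUTE-p8.md` (v7.1 sha256 0b3d2e46…, referee REF g50 landing audit PASS 2026-08-27; v7.2 §78 ff.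
records this edition).  LANDING EDITION (generation 11), module IV of the series «CubeShell I–V» (I–III = `T4CubeShellBlocks` ∕
`T4CubeShellTowerMarkov` ∕ `T4CubeShellResponseStein`), cut from the memo companion `memos/ROUTE-p8-SketchG8.lean` («G8», 979 l.,
57 declarations, 0 `sorry`, 0 `axiom`; farm `lean check` rc 0, `#print axioms` standard): G8 §A :60–:244 (block calculus), G8 §C
:396–:666 (closure under conditioning) and the `merge`-gradient ∕ recursion-data lemmas of G8 §E–§F (:830, :845–:894).  Statements
and proof terms are CHARACTER-IDENTICAL to G8's; edition deltas = namespace (`YMNodeOIdeate.P8g8` → this module's), this header,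
the two-module split with imports, per-declaration cite tags (each names the printed statement the declaration instantiates on the
cube model; proofs ours), one-line docstrings added to helpers G8 left bare, `private` on pure plumbing (`ilab*`,
`div_eq_div_of_factor`).  LABELS (memo-side words, NOT tree declarations): «(D1)»–«(D5)» as in module I's header; labels
`lab : Fin n → Fin 3`: `0` inside, `1` shell, `2` outside.

HONEST FRAMING.  Nothing here is printed in Bałaban's papers and nothing is asserted about his densities: every declaration is
[folklore] calculus ∕ probability — the cube-window, continuous-spin instance of the cited textbook statements — on the TREE's
Euclidean cube model `Balaban1983to89.T4CubePoincare` (`cube n S = [-S,S]ⁿ`, `cubeMean`, the windowed Gibbs law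
`μ_K ∝ e^{-f} 1_K dx`, `HessianBound f λ`) and module I's shell objects (`merge`, `shellMean`, `shellCov`).  The one device that is
an ARRANGEMENT of this series rather than a line of a textbook is the REGULARISED conditioned potential `condPot` (below): the
conditional law given the shell lives on the inside block only; to keep the SAME carrier `Fin n → ℝ` and the SAME window (no
re-indexing of coordinates) the dead directions (shell and outside) are given an independent standard Gaussian-type weight
`(λ/2) Σ z_j²`, which factorises off every conditional expectation of an inside observable ([Durrett2019] Thm 2.1.12) and restores
the uniform convexity `f_xx ≥ λ` in all `n` directions.

WHAT IS PROVED (no `sorry`, no new axiom; `#print axioms` ⊆ {propext, Classical.choice, Quot.sound}).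
* §A functions of the coordinates in `s` (Mathlib `DependsOn Φ s` = [FriedliVelenik2017] Lemma 6.3's «function of `ω_S`»): zero
  partial derivatives off `s` for EVERY `Φ` (`coordGradient_eq_zero_of_dependsOn`, no regularity: `fderiv`'s junk value is `0`);
  the coordinate projection `cproj s` (= Mathlib's `Set.indicator s` pointwise, packaged as a continuous linear map) and
  `Φ = Φ ∘ cproj s`; the chain rule through an affine map `z ↦ c + P z` for first and second Fréchet derivatives ([Spivak1965]
  Thm 2-2, 2-3); hence `DΦ(y) v = DΦ(y)(cproj s v)`, `D²Φ(y)(v, v') = D²Φ(y)(cproj s v, cproj s v')`, `DependsOn (∂_j Φ) s`; and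
  module I's `merge lab x z` as an affine map in each argument (`merge_eq_affine`, `merge_eq_affine_left`).
* §C the regularised conditioned potential `condPot lab λ f₁ x z = f₁ (merge lab x z) + (λ/2) Σ_{lab j ≠ 0} z_j²`: continuous ∕ `C²`
  with `f₁`; **`cubeMean_condPot`**: for `f₁, Φ` blind to the outside block, the windowed Gibbs mean of `Φ ∘ merge lab x` under
  `condPot` IS module I's conditional mean `shellMean lab f₁ S Φ x` (the kernel of [FriedliVelenik2017] (6.110) ∕ Lemma 6.7 (6.7)
  with the Gaussian dummy block factorised off; no continuity of `Φ` needed); **`shellCov_eq_cubeCov_condPot`**: the conditional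
  covariance given the shell is the CUBE COVARIANCE (module I's `cubeCov`) of `condPot`; **`hessianBound_condPot`**: if
  `f₁ + f₂` has `f_xx ≥ λ` with `f₁` outside-blind and `f₂` inside-blind (both `C²`) then `condPot lab λ f₁ x` has `f_xx ≥ λ` —
  the inside–inside block of the Hessian of `f₁ + f₂` is that of `f₁` (the inclusion principle [HornJohnson2013] Thm 4.3.28 for
  the quadratic form), the regulariser supplies `λ` on the dead directions.
* `MergeCalculus`: `∂_i (Φ ∘ merge lab x) = (∂_i Φ) ∘ merge lab x` off the shell and `0` on it, `|∇(Φ ∘ merge lab x)|² ≤ |∇Φ|² ∘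
  merge`; and `shellCov_grad_eq_cubeCov_condPot`: the conditional covariances `Cov(F, ∂_j f₁ | x_shell)` (the recursion data of
  module V's doubling step) are cube covariances of the same class — the class is closed under the step.

NEAREST TREE ∕ MATHLIB ITEMS (dedup census; nothing restated).  USED BY NAME: `Literature.Probability.Distributions.
BrascampLiebCalculus.hasDerivAt_line` (line derivative) and `T4CubeConvexExtension.hasDerivAt_fderiv_line` (second line
derivative at `0`), `T4CubePoincare.hessianBound_iff_fderiv ∕ fderiv_fderiv_combo`, module I's `merge* ∕ shellMean ∕ shellCov ∕
cubeCov_eq_sub`, module II's `volumeReal_mul_setIntegral_mul` (product formula).  SIBLINGS, not duplicates: module II's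
`apply_merge_eq_of_dependsOn` needs agreement on the whole of `s` (here: on the inside block only, for outside-blind `Φ`);
`T4CubeConvexExtension.HessianBoundOn` (convexity on a set) vs. the global `HessianBound` kept here; `BrascampLiebFibre` (fibrewise
Brascamp–Lieb by disintegration of a log-concave law on `ℝ^{n+m}`, product carrier) vs. the same-carrier `condPot` device.
Mathlib: `DependsOn`, `Set.indicator`, `ContinuousLinearMap.pi ∕ proj`, `HasFDerivAt.comp`, `ContDiff.fderiv_right`; Mathlib has
no calculus of `DependsOn` functions.  `div_eq_div_of_factor` duplicates a PRIVATE helper of module II (kept private here too).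

CAVEATS ∕ NOT HERE.  (MODEL) the fibre is `ℝⁿ` with Lebesgue measure and a cube window, as in `T4CubePoincare`; Bałaban's fibre
is a product of group copies read in a chart — that TRANSPORT is not here.  (RAW) `S > 0` wherever a mass is inverted; global
`C¹ ∕ C²` hypotheses (compact window, continuous integrands).  NOT HERE: any decay statement, any BOUND on Bałaban's densities, the
scale-recursion certificate, its seed (Combes–Thomas), balls instead of cubes, [B12] Theorem 2 or the cell's target
`B13TermWalkDataOneTorus.ExistsUniformAcrossSmall`.  Value = kernel-checked calculus ∕ measure-side identities of the cube model,
usable by name; NOT summit progress; no YM-PLAN ∕ Track-B node is claimed closed.  NEW file, imports built tree modules only;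
nothing modified; dimension-generic; net new unproved facts: 0.
[cite: FriedliVelenik2017, Lemma 6.3, Lemma 6.7 (6.7)–(6.10), §6.10.1 (6.110); Spivak1965, Thm 2-2, Thm 2-3, Thm 2-9;
HornJohnson2013, Thm 4.3.28; Durrett2019, Thm 2.1.12; BrascampLieb1976, Thm 4.1; GlimmJaffe1987, §4.3] -/

set_option autoImplicit false

open MeasureTheory Set
open scoped Topology

namespace Literature.MathematicalPhysics.QuantumFieldTheory.Balaban1983to89.T4CubeShellConditional

open Literature.MathematicalPhysics.QuantumFieldTheory.Balaban1983to89.T4CubePoincare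
open Literature.MathematicalPhysics.QuantumFieldTheory.Balaban1983to89.T4CubeShellBlocks
open Literature.MathematicalPhysics.QuantumFieldTheory.Balaban1983to89.T4CubeShellTowerMarkov
open Literature.Probability.Distributions
open Literature.Probability.Distributions.BrascampLiebCalculus (hasDerivAt_line)
open Literature.MathematicalPhysics.QuantumFieldTheory.Balaban1983to89.T4CubeConvexExtension
  (hasDerivAt_fderiv_line)

variable {n : ℕ}

/-! ## §A Block-measurable functions: partial derivatives off the block vanish; derivatives see only the block -/

section BlockCalculus

/-- The line `t ↦ x + t•e_j` has velocity `e_j`. [cite: Spivak1965, Thm 2-2 (chain rule), Thm 2-3 (1)–(2)] -/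
theorem hasDerivAt_line_single (x : Fin n → ℝ) (j : Fin n) (t : ℝ) :
    HasDerivAt (fun s : ℝ => x + s • (Pi.single j 1 : Fin n → ℝ)) (Pi.single j 1) t := by
  have h := ((hasDerivAt_id' t).smul_const (Pi.single j 1 : Fin n → ℝ)).const_add x
  simpa using h

/-- **A function of the coordinates in `s` has zero partial derivatives off `s`** — for EVERY `Φ`
(no differentiability needed: at a point of non-differentiability `fderiv` is the junk value `0`).
[cite: Spivak1965, Thm 2-9; FriedliVelenik2017, Lemma 6.3] -/
theorem coordGradient_eq_zero_of_dependsOn {Φ : (Fin n → ℝ) → ℝ} {s : Set (Fin n)}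
    (hΦ : DependsOn Φ s) {j : Fin n} (hj : j ∉ s) (x : Fin n → ℝ) : coordGradient Φ x j = 0 := by
  unfold coordGradient
  by_cases hd : DifferentiableAt ℝ Φ x
  · have hconst : (fun t : ℝ => Φ (x + t • (Pi.single j 1 : Fin n → ℝ))) = fun _ => Φ x := by
      funext t
      refine hΦ fun i hi => ?_
      have hij : i ≠ j := fun h => hj (h ▸ hi)
      simp [hij]
    have h1 : HasDerivAt (fun t : ℝ => Φ (x + t • (Pi.single j 1 : Fin n → ℝ)))
        (fderiv ℝ Φ x (Pi.single j 1)) 0 :=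
      hd.hasFDerivAt.comp_hasDerivAt_of_eq (0 : ℝ) (hasDerivAt_line_single x j 0) (by simp)
    rw [hconst] at h1
    exact h1.unique (hasDerivAt_const (0 : ℝ) (Φ x))
  · rw [fderiv_zero_of_not_differentiableAt hd]
    rfl

/-- The derivative of a block-measurable `C¹` function inherits nothing new: its partial derivative in a
direction `j` is again a function of the block (trivially `0` off the block, by the previous lemma, and see
`dependsOn_fderiv` for the general statement). [cite: Spivak1965, Thm 2-9; FriedliVelenik2017, Lemma 6.3] -/
theorem coordGradient_dependsOn_of_not_mem {Φ : (Fin n → ℝ) → ℝ} {s : Set (Fin n)}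
    (hΦ : DependsOn Φ s) {j : Fin n} (hj : j ∉ s) : (fun y => coordGradient Φ y j) = fun _ => 0 :=
  funext fun y => coordGradient_eq_zero_of_dependsOn hΦ hj y

open Classical in
/-- The coordinate projection onto the index set `s` (coordinates off `s` are set to `0`), as a continuous
linear map. [folklore] [cite: FriedliVelenik2017, Lemma 6.3] -/
noncomputable def cproj (s : Set (Fin n)) : (Fin n → ℝ) →L[ℝ] (Fin n → ℝ) :=
  ContinuousLinearMap.pi fun i => if i ∈ s then ContinuousLinearMap.proj i else 0

/-- On `s` the projection `cproj s` reads the coordinate (`(ω_S)_i = ω_i`, `i ∈ S`). [cite: FriedliVelenik2017, Lemma 6.3] -/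
theorem cproj_apply_of_mem {s : Set (Fin n)} {i : Fin n} (hi : i ∈ s) (x : Fin n → ℝ) :
    cproj s x i = x i := by
  classical
  simp [cproj, hi]

/-- Off `s` the projection `cproj s` reads `0`. [cite: FriedliVelenik2017, Lemma 6.3] -/
theorem cproj_apply_of_not_mem {s : Set (Fin n)} {i : Fin n} (hi : i ∉ s) (x : Fin n → ℝ) :
    cproj s x i = 0 := by
  classical
  simp [cproj, hi]

/-- `cproj s` is idempotent. [cite: FriedliVelenik2017, Lemma 6.3] -/
theorem cproj_cproj (s : Set (Fin n)) (x : Fin n → ℝ) : cproj s (cproj s x) = cproj s x := by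
  funext i
  by_cases hi : i ∈ s
  · rw [cproj_apply_of_mem hi, cproj_apply_of_mem hi]
  · rw [cproj_apply_of_not_mem hi, cproj_apply_of_not_mem hi]

/-- Two points with the same `s`-coordinates have the same projection. [cite: FriedliVelenik2017, Lemma 6.3] -/
theorem cproj_eq_of_agree {s : Set (Fin n)} {x y : Fin n → ℝ} (h : ∀ i ∈ s, x i = y i) :
    cproj s x = cproj s y := by
  funext i
  by_cases hi : i ∈ s
  · rw [cproj_apply_of_mem hi, cproj_apply_of_mem hi, h i hi]
  · rw [cproj_apply_of_not_mem hi, cproj_apply_of_not_mem hi]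

/-- A block-measurable function factors through the block projection: `Φ = Φ ∘ (0 + cproj s ·)` (written as an
affine precomposition). [cite: FriedliVelenik2017, Lemma 6.3] -/
theorem eq_comp_cproj_of_dependsOn {G : Type*} {Φ : (Fin n → ℝ) → G} {s : Set (Fin n)}
    (hΦ : DependsOn Φ s) : Φ = fun y => Φ ((0 : Fin n → ℝ) + cproj s y) := by
  funext y
  refine hΦ fun i hi => ?_
  rw [Pi.add_apply, cproj_apply_of_mem hi, Pi.zero_apply, zero_add]

variable {G : Type*} [NormedAddCommGroup G] [NormedSpace ℝ G]

/-- Chain rule for an affine precomposition `z ↦ Φ (c + P z)`.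
[cite: Spivak1965, Thm 2-2 (chain rule), Thm 2-3 (1)–(2)] -/
theorem hasFDerivAt_comp_affine {Φ : (Fin n → ℝ) → G} (c : Fin n → ℝ)
    (P : (Fin n → ℝ) →L[ℝ] (Fin n → ℝ)) {z : Fin n → ℝ} (hΦ : DifferentiableAt ℝ Φ (c + P z)) :
    HasFDerivAt (fun z => Φ (c + P z)) ((fderiv ℝ Φ (c + P z)).comp P) z := by
  have hA : HasFDerivAt (fun z : Fin n → ℝ => c + P z) P z := (P.hasFDerivAt).const_add c
  exact hΦ.hasFDerivAt.comp z hA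

/-- `fderiv` form of `hasFDerivAt_comp_affine`: `D(Φ(c + P·))(z) = DΦ(c + Pz) ∘ P`. [cite: Spivak1965, Thm 2-2 (chain rule), Thm 2-3 (1)–(2)] -/
theorem fderiv_comp_affine {Φ : (Fin n → ℝ) → G} (c : Fin n → ℝ)
    (P : (Fin n → ℝ) →L[ℝ] (Fin n → ℝ)) {z : Fin n → ℝ} (hΦ : DifferentiableAt ℝ Φ (c + P z)) :
    fderiv ℝ (fun z => Φ (c + P z)) z = (fderiv ℝ Φ (c + P z)).comp P :=
  (hasFDerivAt_comp_affine c P hΦ).fderiv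

/-- Second-order chain rule for an affine precomposition: the derivative of
`z ↦ DΦ(c + P z) ∘ P` is `w ↦ (D²Φ(c + P z) (P w)) ∘ P`. [cite: Spivak1965, Thm 2-2 (chain rule), Thm 2-3 (1)–(2)] -/
theorem hasFDerivAt_fderiv_comp_affine {Φ : (Fin n → ℝ) → G} (hΦ : ContDiff ℝ 2 Φ) (c : Fin n → ℝ)
    (P : (Fin n → ℝ) →L[ℝ] (Fin n → ℝ)) (z : Fin n → ℝ) :
    HasFDerivAt (fun z => (fderiv ℝ Φ (c + P z)).comp P)
      ((ContinuousLinearMap.precomp G P).comp ((fderiv ℝ (fderiv ℝ Φ) (c + P z)).comp P)) z := by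
  have hD : Differentiable ℝ (fderiv ℝ Φ) :=
    (hΦ.fderiv_right (m := 1) (by norm_num)).differentiable (by norm_num)
  have h2 : HasFDerivAt (fun z => fderiv ℝ Φ (c + P z)) ((fderiv ℝ (fderiv ℝ Φ) (c + P z)).comp P) z :=
    hasFDerivAt_comp_affine c P (hD _)
  have h3 := (ContinuousLinearMap.precomp G P).hasFDerivAt.comp z h2
  refine h3.congr_of_eventuallyEq (Filter.Eventually.of_forall fun w => ?_)
  simp [Function.comp_apply, ContinuousLinearMap.precomp_apply]

/-- The second derivative of an affine precomposition: `D²(Φ(c + P·))(z)[w, w'] = D²Φ(c + P z)[P w, P w']`.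
[cite: Spivak1965, Thm 2-2 (chain rule), Thm 2-3 (1)–(2)] -/
theorem fderiv_fderiv_comp_affine {Φ : (Fin n → ℝ) → G} (hΦ : ContDiff ℝ 2 Φ) (c : Fin n → ℝ)
    (P : (Fin n → ℝ) →L[ℝ] (Fin n → ℝ)) (z w w' : Fin n → ℝ) :
    fderiv ℝ (fderiv ℝ (fun z => Φ (c + P z))) z w w' = fderiv ℝ (fderiv ℝ Φ) (c + P z) (P w) (P w') := by
  have hd : Differentiable ℝ Φ := hΦ.differentiable (by norm_num)
  have e : fderiv ℝ (fun z => Φ (c + P z)) = fun z => (fderiv ℝ Φ (c + P z)).comp P :=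
    funext fun z => fderiv_comp_affine c P (hd _)
  rw [e, (hasFDerivAt_fderiv_comp_affine hΦ c P z).fderiv]
  simp [ContinuousLinearMap.comp_apply, ContinuousLinearMap.precomp_apply]

/-- **First derivatives of a block-measurable function see only the block**: `DΦ(y) v = DΦ(y) (cproj s v)`.
[cite: Spivak1965, Thm 2-9; FriedliVelenik2017, Lemma 6.3] -/
theorem fderiv_apply_eq_fderiv_cproj {Φ : (Fin n → ℝ) → G} {s : Set (Fin n)} (hΦd : DependsOn Φ s)
    (hΦ : Differentiable ℝ Φ) (y v : Fin n → ℝ) : fderiv ℝ Φ y v = fderiv ℝ Φ y (cproj s v) := by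
  have key : ∀ v, fderiv ℝ Φ y v = fderiv ℝ Φ ((0 : Fin n → ℝ) + cproj s y) (cproj s v) := by
    intro v
    have e := eq_comp_cproj_of_dependsOn hΦd
    conv_lhs => rw [e]
    rw [fderiv_comp_affine 0 (cproj s) (hΦ _), ContinuousLinearMap.comp_apply]
  rw [key v, key (cproj s v), cproj_cproj]

/-- … so they vanish on directions supported off the block.
[cite: Spivak1965, Thm 2-9; FriedliVelenik2017, Lemma 6.3] -/
theorem fderiv_apply_eq_zero_of_dependsOn {Φ : (Fin n → ℝ) → G} {s : Set (Fin n)} (hΦd : DependsOn Φ s)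
    (hΦ : Differentiable ℝ Φ) (y : Fin n → ℝ) {v : Fin n → ℝ} (hv : cproj s v = 0) : fderiv ℝ Φ y v = 0 := by
  rw [fderiv_apply_eq_fderiv_cproj hΦd hΦ y v, hv, map_zero]

/-- The derivative of a differentiable block-measurable function is block-measurable.
[cite: Spivak1965, Thm 2-9; FriedliVelenik2017, Lemma 6.3] -/
theorem dependsOn_fderiv {Φ : (Fin n → ℝ) → G} {s : Set (Fin n)} (hΦd : DependsOn Φ s)
    (hΦ : Differentiable ℝ Φ) : DependsOn (fderiv ℝ Φ) s := by
  intro y y' h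
  have e := eq_comp_cproj_of_dependsOn hΦd
  rw [e, fderiv_comp_affine 0 (cproj s) (hΦ _), fderiv_comp_affine 0 (cproj s) (hΦ _), cproj_eq_of_agree h]

/-- In coordinates: each partial derivative of a `C¹` block-measurable function is block-measurable.
[cite: Spivak1965, Thm 2-9; FriedliVelenik2017, Lemma 6.3] -/
theorem dependsOn_coordGradient {Φ : (Fin n → ℝ) → ℝ} {s : Set (Fin n)} (hΦd : DependsOn Φ s)
    (hΦ : ContDiff ℝ 1 Φ) (j : Fin n) : DependsOn (fun y => coordGradient Φ y j) s := by
  intro y y' h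
  simp only [coordGradient]
  rw [dependsOn_fderiv hΦd (hΦ.differentiable one_ne_zero) h]

/-- **Second derivatives of a block-measurable function see only the block**:
`D²Φ(y)[v, v'] = D²Φ(y)[cproj s v, cproj s v']`. [cite: Spivak1965, Thm 2-9; FriedliVelenik2017, Lemma 6.3] -/
theorem fderiv_fderiv_apply_eq_cproj {Φ : (Fin n → ℝ) → G} {s : Set (Fin n)} (hΦd : DependsOn Φ s)
    (hΦ : ContDiff ℝ 2 Φ) (y v v' : Fin n → ℝ) :
    fderiv ℝ (fderiv ℝ Φ) y v v' = fderiv ℝ (fderiv ℝ Φ) y (cproj s v) (cproj s v') := by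
  have key : ∀ v v', fderiv ℝ (fderiv ℝ Φ) y v v'
      = fderiv ℝ (fderiv ℝ Φ) ((0 : Fin n → ℝ) + cproj s y) (cproj s v) (cproj s v') := by
    intro v v'
    have e := eq_comp_cproj_of_dependsOn hΦd
    conv_lhs => rw [e]
    exact fderiv_fderiv_comp_affine hΦ 0 (cproj s) y v v'
  rw [key v v', key (cproj s v) (cproj s v'), cproj_cproj, cproj_cproj]

/-- … so they vanish as soon as one direction is supported off the block.
[cite: Spivak1965, Thm 2-9; FriedliVelenik2017, Lemma 6.3] -/
theorem fderiv_fderiv_eq_zero_of_dependsOn {Φ : (Fin n → ℝ) → G} {s : Set (Fin n)} (hΦd : DependsOn Φ s)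
    (hΦ : ContDiff ℝ 2 Φ) (y : Fin n → ℝ) {v : Fin n → ℝ} (hv : cproj s v = 0) (v' : Fin n → ℝ) :
    fderiv ℝ (fderiv ℝ Φ) y v v' = 0 := by
  rw [fderiv_fderiv_apply_eq_cproj hΦd hΦ, hv, map_zero]
  rfl

/-- `merge lab x ·` is affine: `merge lab x z = merge lab x 0 + cproj {lab ≠ 1} z`.
[cite: FriedliVelenik2017, Lemma 6.7 (6.7)–(6.10)] -/
theorem merge_eq_affine (lab : Fin n → Fin 3) (x z : Fin n → ℝ) :
    merge lab x z = merge lab x 0 + cproj {i | lab i ≠ 1} z := by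
  funext i
  by_cases hi : lab i = 1
  · have hi' : i ∉ {i | lab i ≠ 1} := fun h => h hi
    rw [Pi.add_apply, merge_apply_shell hi, merge_apply_shell hi, cproj_apply_of_not_mem hi', add_zero]
  · have hi' : i ∈ {i | lab i ≠ 1} := hi
    rw [Pi.add_apply, merge_apply_of_ne hi, merge_apply_of_ne hi, cproj_apply_of_mem hi', Pi.zero_apply,
      zero_add]

/-- … and symmetrically affine in the shell configuration: `merge lab x z = merge lab 0 z + cproj {lab = 1} x`.
[cite: FriedliVelenik2017, Lemma 6.7 (6.7)–(6.10)] -/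
theorem merge_eq_affine_left (lab : Fin n → Fin 3) (x z : Fin n → ℝ) :
    merge lab x z = merge lab 0 z + cproj {i | lab i = 1} x := by
  funext i
  by_cases hi : lab i = 1
  · have hi' : i ∈ {i | lab i = 1} := hi
    rw [Pi.add_apply, merge_apply_shell hi, merge_apply_shell hi, cproj_apply_of_mem hi', Pi.zero_apply,
      zero_add]
  · have hi' : i ∉ {i | lab i = 1} := hi
    rw [Pi.add_apply, merge_apply_of_ne hi, merge_apply_of_ne hi, cproj_apply_of_not_mem hi', add_zero]

end BlockCalculus

/-! ## §C Closure under conditioning: the conditional covariance is the cube covariance of a `λ`-convex `C²`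
potential on the SAME carrier and window -/

section Closure

/-- Relabelling for the block factorisation of the conditional law: the inside block keeps label `0`, shell and
outside together form the exchanged block `2`. [folklore] -/
private def ilab (lab : Fin n → Fin 3) (i : Fin n) : Fin 3 := if lab i = 0 then 0 else 2

/-- `ilab` never takes the value `2`. [folklore] -/
private theorem ilab_ne_two {lab : Fin n → Fin 3} {i : Fin n} (hi : lab i = 0) : ilab lab i ≠ 2 := by
  simp only [ilab, hi, if_true]; decide

/-- Off the inside block `ilab` takes the value `2`. [folklore] -/
private theorem ilab_eq_two {lab : Fin n → Fin 3} {i : Fin n} (hi : lab i ≠ 0) : ilab lab i = 2 := by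
  simp only [ilab, hi, if_false]

/-- THE REGULARISED CONDITIONAL POTENTIAL given the shell configuration `x`:
`g_x(z) = f₁(merge lab x z) + (λ/2) Σ_{lab j ≠ 0} z_j²` — the law of the inside block given the shell,
tensorised with an independent windowed `λ`-Gaussian on the dummy (shell ∕ outside) coordinates of `z`, so
that carrier and window stay `Fin n → ℝ`, `[-S,S]ⁿ`.
[folklore] [cite: FriedliVelenik2017, §6.10.1 (6.110); FriedliVelenik2017, Lemma 6.7 (6.7); Durrett2019, Thm 2.1.12] -/
noncomputable def condPot (lab : Fin n → Fin 3) (lam : ℝ) (f₁ : (Fin n → ℝ) → ℝ) (x : Fin n → ℝ) :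
    (Fin n → ℝ) → ℝ :=
  fun z => f₁ (merge lab x z) + lam / 2 * ∑ j ∈ Finset.univ.filter (fun j => lab j ≠ 0), z j ^ 2

/-- The regularised conditional potential is continuous (for continuous `f₁`). [cite: FriedliVelenik2017, §6.10.1 (6.110); Spivak1965, Thm 2-2 (chain rule), Thm 2-3 (1)–(2)] -/
theorem continuous_condPot (lab : Fin n → Fin 3) (lam : ℝ) {f₁ : (Fin n → ℝ) → ℝ} (hf₁ : Continuous f₁)
    (x : Fin n → ℝ) : Continuous (condPot lab lam f₁ x) :=
  (hf₁.comp (continuous_merge_right lab x)).add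
    (continuous_const.mul (continuous_finsetSum _ fun j _ => (continuous_apply j).pow 2))

/-- The Gaussian regulariser `z ↦ (λ/2) Σ_{j ∈ T} z_j²` is smooth. [cite: Spivak1965, Thm 2-3] -/
theorem contDiff_quadReg (lam : ℝ) (T : Finset (Fin n)) {m : WithTop ℕ∞} :
    ContDiff ℝ m (fun z : Fin n → ℝ => lam / 2 * ∑ j ∈ T, z j ^ 2) :=
  contDiff_const.mul (ContDiff.sum fun j _ => (contDiff_apply ℝ ℝ j).pow 2)

/-- `z ↦ merge lab x z` is smooth (it is affine). [cite: Spivak1965, Thm 2-2 (chain rule), Thm 2-3 (1)–(2); FriedliVelenik2017, Lemma 6.7 (6.7)–(6.10)] -/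
theorem contDiff_merge_right (lab : Fin n → Fin 3) (x : Fin n → ℝ) {m : WithTop ℕ∞} :
    ContDiff ℝ m (merge lab x) := by
  rw [show merge lab x = fun z => merge lab x 0 + cproj {i | lab i ≠ 1} z from funext (merge_eq_affine lab x)]
  have h : ContDiff ℝ m (fun z : Fin n → ℝ => (cproj {i | lab i ≠ 1}) z) := (cproj {i | lab i ≠ 1}).contDiff
  exact contDiff_const.add h

/-- `g_x ∈ C²` for `f₁ ∈ C²`.
[cite: FriedliVelenik2017, §6.10.1 (6.110); Spivak1965, Thm 2-2 (chain rule), Thm 2-3 (1)–(2)] -/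
theorem contDiff_condPot (lab : Fin n → Fin 3) (lam : ℝ) {f₁ : (Fin n → ℝ) → ℝ} (hf₁ : ContDiff ℝ 2 f₁)
    (x : Fin n → ℝ) : ContDiff ℝ 2 (condPot lab lam f₁ x) := by
  unfold condPot
  exact (hf₁.comp (contDiff_merge_right lab x)).add (contDiff_quadReg lam _)

/-- First derivative of the quadratic regulariser: `D(λ/2 Σ_T z_j²)(y) w = λ Σ_T y_j w_j`.
[cite: Spivak1965, Thm 2-3] -/
theorem fderiv_quadReg_apply (lam : ℝ) (T : Finset (Fin n)) (y w : Fin n → ℝ) :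
    fderiv ℝ (fun z : Fin n → ℝ => lam / 2 * ∑ j ∈ T, z j ^ 2) y w = lam * ∑ j ∈ T, y j * w j := by
  have hd : Differentiable ℝ (fun z : Fin n → ℝ => lam / 2 * ∑ j ∈ T, z j ^ 2) :=
    (contDiff_quadReg lam T (m := 1)).differentiable one_ne_zero
  have h1 := hasDerivAt_line hd y w 0
  simp only [zero_smul, add_zero] at h1
  have hfun : (fun s : ℝ => lam / 2 * ∑ j ∈ T, (y + s • w) j ^ 2)
      = fun s => lam / 2 * ∑ j ∈ T, (y j + s * w j) * (y j + s * w j) := by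
    funext s
    simp only [Pi.add_apply, Pi.smul_apply, smul_eq_mul, sq]
  rw [hfun] at h1
  have hlin : ∀ j, HasDerivAt (fun s : ℝ => y j + s * w j) (w j) 0 := fun j => by
    simpa using ((hasDerivAt_id (0 : ℝ)).mul_const (w j)).const_add (y j)
  have h2 : HasDerivAt (fun s : ℝ => lam / 2 * ∑ j ∈ T, (y j + s * w j) * (y j + s * w j))
      (lam / 2 * ∑ j ∈ T, (w j * (y j + 0 * w j) + (y j + 0 * w j) * w j)) 0 :=
    (HasDerivAt.fun_sum fun j _ => (hlin j).mul (hlin j)).const_mul (lam / 2)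
  have e := h1.unique h2
  rw [e, Finset.mul_sum, Finset.mul_sum]
  exact Finset.sum_congr rfl fun j _ => by ring

/-- Second derivative of the quadratic regulariser: `D²(λ/2 Σ_T z_j²)(y)(w, w) = λ Σ_T w_j²`.
[cite: Spivak1965, Thm 2-3] -/
theorem fderiv_fderiv_quadReg (lam : ℝ) (T : Finset (Fin n)) (y w : Fin n → ℝ) :
    fderiv ℝ (fderiv ℝ (fun z : Fin n → ℝ => lam / 2 * ∑ j ∈ T, z j ^ 2)) y w w = lam * ∑ j ∈ T, w j * w j := by
  have h1 := hasDerivAt_fderiv_line (contDiff_quadReg lam T (m := 2)) y w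
  have hfun : (fun t : ℝ => fderiv ℝ (fun z : Fin n → ℝ => lam / 2 * ∑ j ∈ T, z j ^ 2) (y + t • w) w)
      = fun t => lam * ∑ j ∈ T, (y j + t * w j) * w j := by
    funext t
    rw [fderiv_quadReg_apply]
    simp only [Pi.add_apply, Pi.smul_apply, smul_eq_mul]
  rw [hfun] at h1
  have hlin : ∀ j, HasDerivAt (fun s : ℝ => y j + s * w j) (w j) 0 := fun j => by
    simpa using ((hasDerivAt_id (0 : ℝ)).mul_const (w j)).const_add (y j)
  have h2 : HasDerivAt (fun t : ℝ => lam * ∑ j ∈ T, (y j + t * w j) * w j) (lam * ∑ j ∈ T, w j * w j) 0 :=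
    (HasDerivAt.fun_sum fun j _ => (hlin j).mul_const (w j)).const_mul lam
  exact h1.unique h2

/-- Mirror of the tree's `apply_merge_eq_of_dependsOn_outside`: a function blind to the OUTSIDE block,
composed with `merge lab x ·`, sees only the inside block of `z`.
[cite: FriedliVelenik2017, Lemma 6.3; FriedliVelenik2017, Lemma 6.7 (6.7)–(6.10)] -/
theorem apply_merge_eq_of_dependsOn_inside {lab : Fin n → Fin 3} {Φ : (Fin n → ℝ) → ℝ}
    (hΦ : DependsOn Φ {i | lab i ≠ 2}) (x : Fin n → ℝ) {z z' : Fin n → ℝ}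
    (h : ∀ i ∈ {i | lab i = 0}, z i = z' i) : Φ (merge lab x z) = Φ (merge lab x z') := by
  apply hΦ
  intro i hi
  by_cases h1 : lab i = 1
  · rw [merge_apply_shell h1, merge_apply_shell h1]
  · rw [merge_apply_of_ne h1, merge_apply_of_ne h1]
    have hi' : lab i ≠ 2 := hi
    have h0 : lab i = 0 := by
      have key : ∀ c : Fin 3, c ≠ 1 → c ≠ 2 → c = 0 := by decide
      exact key _ h1 hi'
    exact h i h0

/-- Cancelling a common nonzero factor (the cube volume `V`) from two factorised products:
`V·X = A·C`, `V·Y = B·C` ⇒ `X/Y = A/B` (the tree's private `div_eq_div_of_factor`). [folklore] -/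
private theorem div_eq_div_of_factor {V X Y A B C : ℝ} (hV : V ≠ 0) (hY : Y ≠ 0) (hB : B ≠ 0)
    (h1 : V * X = A * C) (h2 : V * Y = B * C) : X / Y = A / B := by
  rw [div_eq_div_iff hY hB]
  exact mul_left_cancel₀ hV (by linear_combination B * h1 - A * h2)

/-- **THE CONDITIONAL MEAN IS A CUBE MEAN (PROVED).**  For an insert `Φ` and a potential `f₁` both blind to the
outside block, `E_{μ_K}[Φ | x_shell] = ⟨Φ ∘ merge lab x⟩_{K, g_x}` with `g_x = condPot lab λ f₁ x`: the dummy
Gaussian block factorises off (`volumeReal_mul_setIntegral_mul` for the relabelling `ilab`).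
[cite: FriedliVelenik2017, Lemma 6.7 (6.7); Durrett2019, Thm 2.1.12; FriedliVelenik2017, §6.10.1 (6.110)] -/
theorem cubeMean_condPot {S : ℝ} (hS : 0 < S) (lab : Fin n → Fin 3) (lam : ℝ) {f₁ Φ : (Fin n → ℝ) → ℝ}
    (hf₁ : Continuous f₁) (hf₁d : DependsOn f₁ {i | lab i ≠ 2}) (hΦd : DependsOn Φ {i | lab i ≠ 2})
    (x : Fin n → ℝ) :
    cubeMean (condPot lab lam f₁ x) S (fun z => Φ (merge lab x z)) = shellMean lab f₁ S Φ x := by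
  have hK : IsCompact (cube n S) := isCompact_cube n S
  have hV : (volume : Measure (Fin n → ℝ)).real (cube n S) ≠ 0 := by
    rw [measureReal_def]
    exact (ENNReal.toReal_pos (volume_cube_pos' n hS).ne' hK.measure_lt_top.ne).ne'
  -- block dependence of the three factors
  have da : DependsOn (fun z => Φ (merge lab x z) * Real.exp (-f₁ (merge lab x z))) {i | ilab lab i ≠ 2} := by
    intro z z' h
    have h0 : ∀ i ∈ {i | lab i = 0}, z i = z' i := fun i hi => h i (ilab_ne_two hi)
    show Φ (merge lab x z) * Real.exp (-f₁ (merge lab x z)) = Φ (merge lab x z') * Real.exp (-f₁ (merge lab x z'))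
    rw [apply_merge_eq_of_dependsOn_inside hΦd x h0, apply_merge_eq_of_dependsOn_inside hf₁d x h0]
  have da₁ : DependsOn (fun z => Real.exp (-f₁ (merge lab x z))) {i | ilab lab i ≠ 2} := by
    intro z z' h
    have h0 : ∀ i ∈ {i | lab i = 0}, z i = z' i := fun i hi => h i (ilab_ne_two hi)
    show Real.exp (-f₁ (merge lab x z)) = Real.exp (-f₁ (merge lab x z'))
    rw [apply_merge_eq_of_dependsOn_inside hf₁d x h0]
  have db : DependsOn (fun z : Fin n → ℝ =>
      Real.exp (-(lam / 2 * ∑ j ∈ Finset.univ.filter (fun j => lab j ≠ 0), z j ^ 2))) {i | ilab lab i = 2} := by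
    intro z z' h
    show Real.exp (-(lam / 2 * ∑ j ∈ Finset.univ.filter (fun j => lab j ≠ 0), z j ^ 2))
      = Real.exp (-(lam / 2 * ∑ j ∈ Finset.univ.filter (fun j => lab j ≠ 0), z' j ^ 2))
    congr 3
    exact Finset.sum_congr rfl fun j hj => by
      rw [Finset.mem_filter] at hj
      rw [h j (ilab_eq_two hj.2)]
  have e1 := volumeReal_mul_setIntegral_mul (ilab lab) S da db
  have e2 := volumeReal_mul_setIntegral_mul (ilab lab) S da₁ db
  have hexp : ∀ z, Real.exp (-(condPot lab lam f₁ x z)) = Real.exp (-f₁ (merge lab x z))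
      * Real.exp (-(lam / 2 * ∑ j ∈ Finset.univ.filter (fun j => lab j ≠ 0), z j ^ 2)) := by
    intro z
    rw [← Real.exp_add]
    congr 1
    simp only [condPot]
    ring
  have num : (∫ z in cube n S, Φ (merge lab x z) * Real.exp (-(condPot lab lam f₁ x z)))
      = ∫ z in cube n S, (Φ (merge lab x z) * Real.exp (-f₁ (merge lab x z)))
          * Real.exp (-(lam / 2 * ∑ j ∈ Finset.univ.filter (fun j => lab j ≠ 0), z j ^ 2)) := by
    congr 1
    funext z
    rw [hexp, mul_assoc]
  have den : (∫ z in cube n S, Real.exp (-(condPot lab lam f₁ x z)))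
      = ∫ z in cube n S, Real.exp (-f₁ (merge lab x z))
          * Real.exp (-(lam / 2 * ∑ j ∈ Finset.univ.filter (fun j => lab j ≠ 0), z j ^ 2)) := by
    congr 1
    funext z
    exact hexp z
  have hY : (∫ z in cube n S, Real.exp (-f₁ (merge lab x z))
      * Real.exp (-(lam / 2 * ∑ j ∈ Finset.univ.filter (fun j => lab j ≠ 0), z j ^ 2))) ≠ 0 := by
    rw [← den]
    exact (setIntegral_exp_neg_pos (continuous_condPot lab lam hf₁ x) hS).ne'
  have hB : (∫ z in cube n S, Real.exp (-f₁ (merge lab x z))) ≠ 0 := (shellMass_pos lab hf₁ hS x).ne'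
  simp only [cubeMean, cubeMass, shellMean, shellMass]
  rw [num, den]
  exact div_eq_div_of_factor hV hY hB e1 e2

/-- **THE CONDITIONAL COVARIANCE IS A CUBE COVARIANCE (PROVED)** — closure of the class under conditioning,
without re-indexing: for inserts `F, G` and a potential `f₁` all blind to the outside block,
`Cov_{μ_K}(F, G | x_shell) = Cov_{K, g_x}(F ∘ merge lab x, G ∘ merge lab x)`.  In the doubling scheme this is
applied with `G = ∂_j f₁` (`dependsOn_coordGradient`), so that THE STEP's `β_j` are again cube covariances of the
same kind at half the distance, for the potential `g_x ∈ C²` with `HessianBound g_x λ` (next two lemmas).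
[cite: FriedliVelenik2017, Lemma 6.7 (6.7); Durrett2019, Thm 2.1.12; GlimmJaffe1987, §4.3 (proof of Cor. 4.3.3)] -/
theorem shellCov_eq_cubeCov_condPot {S : ℝ} (hS : 0 < S) (lab : Fin n → Fin 3) (lam : ℝ)
    {f₁ F G : (Fin n → ℝ) → ℝ} (hf₁ : Continuous f₁) (hF : Continuous F) (hG : Continuous G)
    (hf₁d : DependsOn f₁ {i | lab i ≠ 2}) (hFd : DependsOn F {i | lab i ≠ 2}) (hGd : DependsOn G {i | lab i ≠ 2})
    (x : Fin n → ℝ) :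
    shellCov lab f₁ S F G x
      = cubeCov (condPot lab lam f₁ x) S (fun z => F (merge lab x z)) (fun z => G (merge lab x z)) := by
  have hg : Continuous (condPot lab lam f₁ x) := continuous_condPot lab lam hf₁ x
  have hm : Continuous (merge lab x) := continuous_merge_right lab x
  have hFG : DependsOn (fun y => F y * G y) {i | lab i ≠ 2} := by
    intro y y' h
    show F y * G y = F y' * G y'
    rw [hFd h, hGd h]
  rw [cubeCov_eq_sub hS hg (F := fun z => F (merge lab x z)) (G := fun z => G (merge lab x z)) (hF.comp hm)
    (hG.comp hm)]
  show _ = cubeMean (condPot lab lam f₁ x) S (fun z => F (merge lab x z) * G (merge lab x z)) -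
      cubeMean (condPot lab lam f₁ x) S (fun z => F (merge lab x z)) *
        cubeMean (condPot lab lam f₁ x) S (fun z => G (merge lab x z))
  rw [cubeMean_condPot hS lab lam hf₁ hf₁d hFG x, cubeMean_condPot hS lab lam hf₁ hf₁d hFd x,
    cubeMean_condPot hS lab lam hf₁ hf₁d hGd x]
  rfl

/-- **THE REGULARISED CONDITIONAL POTENTIAL IS AGAIN `λ`-CONVEX (PROVED).**  If `f₁ + f₂` has `HessianBound · λ`
with `f₁` blind to the outside and `f₂` blind to the inside block, then for every shell configuration `x`
`HessianBound (condPot lab λ f₁ x) λ`: on inside directions `u` one has `D²f₂[u,u] = 0`, so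
`D²f₁(merge x z)[u,u] = D²(f₁+f₂)[u,u] ≥ λ|u|²`, and the regulariser supplies `λ|w|²` on the other directions.
[cite: HornJohnson2013, Thm 4.3.28 (4.3.30); BrascampLieb1976, Thm 4.1] -/
theorem hessianBound_condPot {lam : ℝ} (lab : Fin n → Fin 3) {f₁ f₂ : (Fin n → ℝ) → ℝ}
    (hf₁ : ContDiff ℝ 2 f₁) (hf₂ : ContDiff ℝ 2 f₂) (hB : HessianBound (f₁ + f₂) lam)
    (hf₁d : DependsOn f₁ {i | lab i ≠ 2}) (hf₂d : DependsOn f₂ {i | lab i ≠ 0}) (x : Fin n → ℝ) :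
    HessianBound (condPot lab lam f₁ x) lam := by
  set c : Fin n → ℝ := merge lab x 0 with hc
  set P : (Fin n → ℝ) →L[ℝ] (Fin n → ℝ) := cproj {i | lab i ≠ 1} with hP
  set T : Finset (Fin n) := Finset.univ.filter (fun j => lab j ≠ 0) with hT
  have hφ2 : ContDiff ℝ 2 (fun z : Fin n → ℝ => f₁ (c + P z)) :=
    hf₁.comp (contDiff_const.add P.contDiff)
  have hq2 : ContDiff ℝ 2 (fun z : Fin n → ℝ => lam / 2 * ∑ j ∈ T, z j ^ 2) := contDiff_quadReg lam T
  have hg : condPot lab lam f₁ x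
      = fun z => 1 * (fun z : Fin n → ℝ => f₁ (c + P z)) z + 1 * (fun z : Fin n → ℝ => lam / 2 * ∑ j ∈ T, z j ^ 2) z := by
    funext z
    simp only [condPot, one_mul, hT]
    rw [merge_eq_affine lab x z]
  rw [hessianBound_iff_fderiv (contDiff_condPot lab lam hf₁ x)]
  intro z w
  rw [hg, fderiv_fderiv_combo hφ2 hq2 1 1 z w w, one_mul, one_mul, fderiv_fderiv_comp_affine hf₁ c P z w w,
    fderiv_fderiv_quadReg lam T z w]
  -- the inside part of `w`
  set u : Fin n → ℝ := cproj {i | lab i = 0} w with hu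
  have hu_apply : ∀ i, u i = if lab i = 0 then w i else 0 := by
    intro i
    by_cases hi : lab i = 0
    · rw [if_pos hi]; exact cproj_apply_of_mem (show i ∈ {i | lab i = 0} from hi) w
    · rw [if_neg hi]; exact cproj_apply_of_not_mem (show i ∉ {i | lab i = 0} from hi) w
  have hPw : cproj {i | lab i ≠ 2} (P w) = u := by
    funext i
    rw [hu_apply]
    by_cases h2 : lab i = 2
    · have hi : i ∉ {i | lab i ≠ 2} := fun h => h h2
      rw [cproj_apply_of_not_mem hi, if_neg (by rw [h2]; decide)]
    · have hi : i ∈ {i | lab i ≠ 2} := h2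
      rw [cproj_apply_of_mem hi]
      by_cases h1 : lab i = 1
      · have hi1 : i ∉ {i | lab i ≠ 1} := fun h => h h1
        rw [hP, cproj_apply_of_not_mem hi1, if_neg (by rw [h1]; decide)]
      · have hi1 : i ∈ {i | lab i ≠ 1} := h1
        have h0 : lab i = 0 := by
          have key : ∀ c : Fin 3, c ≠ 1 → c ≠ 2 → c = 0 := by decide
          exact key _ h1 h2
        rw [hP, cproj_apply_of_mem hi1, if_pos h0]
  have hu0 : cproj {i | lab i ≠ 0} u = 0 := by
    funext i
    rw [Pi.zero_apply]
    by_cases h0 : lab i = 0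
    · exact cproj_apply_of_not_mem (show i ∉ {i | lab i ≠ 0} from fun h => h h0) u
    · rw [cproj_apply_of_mem (show i ∈ {i | lab i ≠ 0} from h0), hu_apply, if_neg h0]
  -- `D²f₁(y)[Pw, Pw] = D²f₁(y)[u, u] = D²(f₁ + f₂)(y)[u, u] ≥ λ |u|²`
  have e1 : fderiv ℝ (fderiv ℝ f₁) (c + P z) (P w) (P w) = fderiv ℝ (fderiv ℝ f₁) (c + P z) u u := by
    rw [fderiv_fderiv_apply_eq_cproj hf₁d hf₁ (c + P z) (P w) (P w), hPw,
      fderiv_fderiv_apply_eq_cproj hf₁d hf₁ (c + P z) u u, ← hPw, cproj_cproj]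
  have e2 : fderiv ℝ (fderiv ℝ f₂) (c + P z) u u = 0 :=
    fderiv_fderiv_eq_zero_of_dependsOn hf₂d hf₂ (c + P z) hu0 u
  have e3 : fderiv ℝ (fderiv ℝ (f₁ + f₂)) (c + P z) u u
      = fderiv ℝ (fderiv ℝ f₁) (c + P z) u u + fderiv ℝ (fderiv ℝ f₂) (c + P z) u u := by
    have h12 : (f₁ + f₂) = fun y => 1 * f₁ y + 1 * f₂ y := by
      funext y
      simp only [Pi.add_apply, one_mul]
    rw [h12, fderiv_fderiv_combo hf₁ hf₂ 1 1, one_mul, one_mul]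
  have hBu := (hessianBound_iff_fderiv (f := f₁ + f₂) (hf₁.add hf₂)).1 hB (c + P z) u
  rw [e3, e2, add_zero] at hBu
  -- sums
  have huu : u ⬝ᵥ u = ∑ j ∈ Finset.univ.filter (fun j => lab j = 0), w j * w j := by
    rw [Finset.sum_filter]
    refine Finset.sum_congr rfl fun j _ => ?_
    rw [hu_apply]
    split_ifs <;> simp
  have hww : w ⬝ᵥ w = (∑ j ∈ Finset.univ.filter (fun j => lab j = 0), w j * w j) + ∑ j ∈ T, w j * w j := by
    rw [hT]
    exact (Finset.sum_filter_add_sum_filter_not Finset.univ (fun j => lab j = 0) fun j => w j * w j).symm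
  rw [e1, hww, mul_add]
  rw [huu] at hBu
  linarith

end Closure

/-! ## Gradients through `merge`, and the recursion data of the doubling step as conditional-class covariances -/

section MergeCalculus

/-- `cproj s` fixes the basis vector `e_i` for `i ∈ s`. [cite: FriedliVelenik2017, Lemma 6.3] -/
theorem cproj_single_of_mem {s : Set (Fin n)} {i : Fin n} (hi : i ∈ s) :
    cproj s (Pi.single i (1 : ℝ)) = Pi.single i 1 := by
  funext k
  by_cases hk : k ∈ s
  · exact cproj_apply_of_mem hk _
  · rw [cproj_apply_of_not_mem hk]
    have hki : k ≠ i := fun h => hk (h ▸ hi)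
    rw [Pi.single_eq_of_ne hki]

/-- `cproj s` kills the basis vector `e_i` for `i ∉ s`. [cite: FriedliVelenik2017, Lemma 6.3] -/
theorem cproj_single_of_not_mem {s : Set (Fin n)} {i : Fin n} (hi : i ∉ s) :
    cproj s (Pi.single i (1 : ℝ)) = 0 := by
  funext k
  rw [Pi.zero_apply]
  by_cases hk : k ∈ s
  · rw [cproj_apply_of_mem hk]
    have hki : k ≠ i := fun h => hi (h ▸ hk)
    rw [Pi.single_eq_of_ne hki]
  · exact cproj_apply_of_not_mem hk _

/-- **Gradient of an insert composed with `merge lab x ·`**: only the non-shell coordinates survive,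
`∂_i (Φ ∘ merge lab x)(z) = ∂_i Φ(merge lab x z)` for `lab i ≠ 1`, `= 0` for shell `i`.
[cite: Spivak1965, Thm 2-9; FriedliVelenik2017, Lemma 6.3; FriedliVelenik2017, Lemma 6.7 (6.7)–(6.10)] -/
theorem coordGradient_comp_merge_right (lab : Fin n → Fin 3) {Φ : (Fin n → ℝ) → ℝ} (hΦ : Differentiable ℝ Φ)
    (x z : Fin n → ℝ) (i : Fin n) :
    coordGradient (fun z' => Φ (merge lab x z')) z i
      = if lab i ≠ 1 then coordGradient Φ (merge lab x z) i else 0 := by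
  have hfun : (fun z' => Φ (merge lab x z')) = fun z' => Φ (merge lab x 0 + cproj {i | lab i ≠ 1} z') := by
    funext z'
    rw [merge_eq_affine lab x z']
  have hpt : merge lab x 0 + cproj {i | lab i ≠ 1} z = merge lab x z := (merge_eq_affine lab x z).symm
  simp only [coordGradient]
  rw [hfun, fderiv_comp_affine (G := ℝ) (merge lab x 0) (cproj {i | lab i ≠ 1}) (z := z) (by rw [hpt]; exact hΦ _),
    ContinuousLinearMap.comp_apply, hpt]
  by_cases hi : lab i ≠ 1
  · rw [if_pos hi, cproj_single_of_mem (show i ∈ {i | lab i ≠ 1} from hi)]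
  · rw [if_neg hi, cproj_single_of_not_mem (show i ∉ {i | lab i ≠ 1} from hi), map_zero]

/-- `|∇(Φ ∘ merge lab x)(z)|² ≤ |∇Φ(merge lab x z)|²`.
[cite: Spivak1965, Thm 2-9; FriedliVelenik2017, Lemma 6.3; FriedliVelenik2017, Lemma 6.7 (6.7)–(6.10)] -/
theorem gradSq_comp_merge_le (lab : Fin n → Fin 3) {Φ : (Fin n → ℝ) → ℝ} (hΦ : Differentiable ℝ Φ)
    (x z : Fin n → ℝ) :
    coordGradient (fun z' => Φ (merge lab x z')) z ⬝ᵥ coordGradient (fun z' => Φ (merge lab x z')) z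
      ≤ coordGradient Φ (merge lab x z) ⬝ᵥ coordGradient Φ (merge lab x z) := by
  refine Finset.sum_le_sum fun i _ => ?_
  rw [coordGradient_comp_merge_right lab hΦ x z i]
  split_ifs
  · exact le_rfl
  · simpa using mul_self_nonneg (coordGradient Φ (merge lab x z) i)

/-- **THE RECURSION CLOSES IN THE SAME CLASS (PROVED):** the `β_j` of THE STEP — conditional covariances
`Cov(F, ∂_j f₁ | x_shell)` — are cube covariances, on the SAME carrier and window, of the inserts
`F ∘ merge lab x`, `∂_j f₁ ∘ merge lab x` under the potential `g_x = condPot lab λ f₁ x`, which is `C²`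
(`contDiff_condPot`) with `HessianBound g_x λ` (`hessianBound_condPot`); so THE STEP applies to them again at half
the distance (with the inside block of `lab` refined into inside′ ∕ shell′ ∕ outside′).
[cite: FriedliVelenik2017, Lemma 6.7 (6.7); Durrett2019, Thm 2.1.12; GlimmJaffe1987, §4.3 (proof of Cor. 4.3.3)] -/
theorem shellCov_grad_eq_cubeCov_condPot {S : ℝ} (hS : 0 < S) (lab : Fin n → Fin 3) (lam : ℝ)
    {f₁ F : (Fin n → ℝ) → ℝ} (hf₁ : ContDiff ℝ 1 f₁) (hF : Continuous F) (hf₁d : DependsOn f₁ {i | lab i ≠ 2})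
    (hFd : DependsOn F {i | lab i ≠ 2}) (x : Fin n → ℝ) (j : Fin n) :
    shellCov lab f₁ S F (fun y => coordGradient f₁ y j) x
      = cubeCov (condPot lab lam f₁ x) S (fun z => F (merge lab x z))
          (fun z => coordGradient f₁ (merge lab x z) j) :=
  shellCov_eq_cubeCov_condPot hS lab lam hf₁.continuous hF
    ((continuous_apply j).comp (continuous_coordGradient hf₁)) hf₁d hFd (dependsOn_coordGradient hf₁d hf₁ j) x

end MergeCalculus

end Literature.MathematicalPhysics.QuantumFieldTheory.Balaban1983to89.T4CubeShellConditional
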